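import Summits.QuantumAdvantage.AdviceFreeQNC0.CovLogSuffices
import Summits.QuantumAdvantage.AdviceFreeQNC0.LiftCost
import Summits.QuantumAdvantage.AdviceFreeQNC0.LiftCostFibres
import HarnessLib

/-!
# From a TRANSVERSAL to a LIFT: `cov ≤ |Z|` ⟹ a lift of cost `≤ 2^{L−1}·|Z|`
# (the bookkeeping half of qn-p2's THEOREMS E1/E2/E3, done once for every co-degree)

Cell qa-qnc0 (route `QuantumAdvantage/RingFrame`, crux α = stmt-QuantumAdvantage-19119, tensor line), seat qa-qnc0-lit
gen 10.  Planner qa-qnc0-p2 ROUND-5 §2 bounds, for a matrix `X` with linear columns whose rows are close to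
`C = RM(d, L')`, the COVERING NUMBER `cov` of the system of cosets `{X(u,·) + C}_u`: a set `Z ⊆ {0,1}^{L'}` such that
every coset `X(u,·) + C` has a representative supported inside `Z` ("transversal").  THEOREMS E1–E3 then conclude
`lift cost ≤ 2^{L−1}·cov` (§2: "Lift cost ≤ 2^{L−1}(d+3)", "cov ≤ 6m+4 … `CostBoundCodegTwo`").  This file proves
that implication in general, so that E2/E3 (asks R5-a, …) reduce to the pure covering statements:

`exists_lift_of_transversal`: `LinCols X`, and for every row `u` some `v_u` supported in `Z` with
`X(u,·) ⊕ v_u` of degree `≤ d`  ⟹  `∃ W, LinCols W ∧ RowsDeg d W ∧ hw (X ⊕ W) ≤ 2^{L−1}·#Z`.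

Proof (generalising `CodegOne.liftW`, which is the case `Z = {0, e_1, …, e_m}` with the explicit section `zRep`):
choose correctors `v_i` for the basis rows `e_i` only and extend LINEARLY, `ρ(u) = Σ_{i : u_i = 1} v_i` (over `𝔽₂`),
`W(u,·) = X(u,·) ⊕ ρ(u)`.  Rows: `X(u,·) = Σ_{u_i = 1} X(e_i,·)` because the columns are linear
(`apply_eq_sum_basis_of_linCols`), so `W(u,·) = Σ_{u_i=1} (X(e_i,·) ⊕ v_i) ∈ RM(d)`.  Columns: `u ↦ ρ(u)(p)` is a
linear form, so `W` has linear columns (`hasDeg_one_of_additive`).  Cost: `X ⊕ W = ρ` is supported in the columns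
`Z`, and a matrix with linear columns has exactly `2^{L−1}` ones in each non-zero column (`hw_xorM_eq_of_linCols`).

WHAT THIS IS NOT: no covering bound is proved here (that is E2/E3's content); nothing about crux α; separation NOT moved.
-/

namespace Summit.QuantumAdvantage.AdviceFreeQNC0

open Finset
open Literature.Computability.MetaComplexity Literature.Computability.MetaComplexity.Smolensky
open MeanLoad

variable {L L' : ℕ}

namespace LiftFromTransversal

/-- `𝔽₂`-indicator of a Boolean vector. -/
def indB (g : (Fin L' → Bool) → Bool) : CubeFn (ZMod 2) L' := fun p => if g p = true then 1 else 0

/-- Unfolding `indB`. -/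
@[simp] theorem indB_apply (g : (Fin L' → Bool) → Bool) (p : Fin L' → Bool) :
    indB g p = if g p = true then 1 else 0 := rfl

/-- The linear extension `ρ(u) = Σ_{i : u_i = 1} v_i` of a family of correctors `v_i`, as an `𝔽₂`-valued function. -/
def rho (v : Fin L → (Fin L' → Bool) → Bool) (u : Fin L → Bool) : CubeFn (ZMod 2) L' :=
  ∑ i, (if u i = true then (1 : ZMod 2) else 0) • indB (v i)

/-- The lifted matrix `W(u,·) = X(u,·) ⊕ ρ(u)`. -/
def liftZ (X : BMat L L') (v : Fin L → (Fin L' → Bool) → Bool) : BMat L L' :=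
  fun u p => xor (X u p) (decide (rho v u p = 1))

/-- In `𝔽₂`, the indicator of `z = 1` is `z`. -/
theorem zmod2_ind_decide (z : ZMod 2) : (if decide (z = 1) = true then (1 : ZMod 2) else 0) = z := by
  have h01 : ∀ z : ZMod 2, z = 0 ∨ z = 1 := by decide
  rcases h01 z with h | h
  · rw [h]; decide
  · rw [h]; decide

/-- `ρ` is additive in `u`. -/
theorem rho_bx (v : Fin L → (Fin L' → Bool) → Bool) (u u' : Fin L → Bool) :
    rho v (bx u u') = rho v u + rho v u' := by
  unfold rho
  rw [← sum_add_distrib]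
  refine sum_congr rfl fun i _ => ?_
  rw [← add_smul]
  congr 1
  exact ind_xor (u i) (u' i)

/-- `ρ(0) = 0`. -/
theorem rho_zero (v : Fin L → (Fin L' → Bool) → Bool) : rho v (fun _ => false) = 0 := by
  unfold rho
  exact sum_eq_zero fun i _ => by simp

/-- Row indicator of the lift: `ind W(u,·) = ind X(u,·) + ρ(u)`. -/
theorem ind_liftZ (X : BMat L L') (v : Fin L → (Fin L' → Bool) → Bool) (u : Fin L → Bool) :
    (fun p => if liftZ X v u p = true then (1 : ZMod 2) else 0) = indB (X u) + rho v u := by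
  funext p
  rw [Pi.add_apply, indB_apply]
  unfold liftZ
  rw [ind_xor, zmod2_ind_decide]

/-- Rows of `X` are the `𝔽₂`-combinations of its basis rows (linear columns). -/
theorem indB_row_eq_sum {X : BMat L L'} (hX : LinCols X) (u : Fin L → Bool) :
    indB (X u) = ∑ i, (if u i = true then (1 : ZMod 2) else 0) • indB (X (basisRow i)) := by
  funext p
  rw [indB_apply, apply_eq_sum_basis_of_linCols hX u p, Finset.sum_apply]
  refine sum_congr rfl fun i _ => ?_
  rw [Pi.smul_apply, smul_eq_mul, indB_apply]

/-- The rows of the lift have degree `≤ d` as soon as the corrected basis rows do. -/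
theorem rowsDeg_liftZ {d : ℕ} {X : BMat L L'} (hX : LinCols X) {v : Fin L → (Fin L' → Bool) → Bool}
    (hv : ∀ i, HasDeg (fun p => xor (X (basisRow i) p) (v i p)) d) : RowsDeg d (liftZ X v) := by
  intro u
  show (fun p => if liftZ X v u p = true then (1 : ZMod 2) else 0) ∈ lowDeg (ZMod 2) L' d
  rw [ind_liftZ, indB_row_eq_sum hX u]
  unfold rho
  rw [← sum_add_distrib]
  refine Submodule.sum_mem _ fun i _ => ?_
  rw [← smul_add]
  refine Submodule.smul_mem _ _ ?_
  have h := hv i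
  unfold HasDeg at h
  have e : (fun p => if xor (X (basisRow i) p) (v i p) = true then (1 : ZMod 2) else 0) =
      indB (X (basisRow i)) + indB (v i) := by
    funext p
    rw [Pi.add_apply, indB_apply, indB_apply, ind_xor]
  rw [← e]
  exact h

/-- The lift is additive in the row index. -/
theorem liftZ_bx {X : BMat L L'} (hX : LinCols X) (v : Fin L → (Fin L' → Bool) → Bool)
    (u u' : Fin L → Bool) (p : Fin L' → Bool) :
    liftZ X v (bx u u') p = xor (liftZ X v u p) (liftZ X v u' p) := by
  apply eq_of_ind_eq
  have h1 := congr_fun (ind_liftZ X v (bx u u')) p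
  have h2 := congr_fun (ind_liftZ X v u) p
  have h3 := congr_fun (ind_liftZ X v u') p
  rw [ind_xor, h1, h2, h3, Pi.add_apply, Pi.add_apply, Pi.add_apply, rho_bx, Pi.add_apply, indB_apply,
    indB_apply, indB_apply, apply_bx_of_linCols hX, ind_xor]
  ring

/-- The lift has linear columns. -/
theorem linCols_liftZ {X : BMat L L'} (hX : LinCols X) (v : Fin L → (Fin L' → Bool) → Bool) :
    LinCols (liftZ X v) := by
  refine ⟨fun p => hasDeg_one_of_additive fun u u' => liftZ_bx hX v u u' p, fun p => ?_⟩
  unfold liftZ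
  rw [hX.2 p, rho_zero, Pi.zero_apply]
  decide

/-- The lift differs from `X` only inside the support of the correctors. -/
theorem colDiff_liftZ_subset {X : BMat L L'} (v : Fin L → (Fin L' → Bool) → Bool) (Z : Finset (Fin L' → Bool))
    (hvZ : ∀ i p, v i p = true → p ∈ Z) : colDiff X (liftZ X v) ⊆ Z := by
  intro p hp
  obtain ⟨u, hu⟩ := (mem_filter.1 hp).2
  unfold liftZ at hu
  have hρ : rho v u p ≠ 0 := by
    intro h0
    apply hu
    rw [h0]
    cases X u p <;> decide
  unfold rho at hρ
  rw [Finset.sum_apply] at hρ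
  obtain ⟨i, _, hi⟩ := exists_ne_zero_of_sum_ne_zero hρ
  rw [Pi.smul_apply, smul_eq_mul, indB_apply] at hi
  by_cases hvi : v i p = true
  · exact hvZ i p hvi
  · rw [if_neg hvi, mul_zero] at hi
    exact absurd rfl hi

end LiftFromTransversal

open LiftFromTransversal in
/-- **Transversal ⟹ lift.**  If `X` has linear columns and every row coset `X(u,·) + RM(d, L')` has a
representative `v_u` supported inside `Z` (i.e. `X(u,·) ⊕ v_u` has degree `≤ d` and `v_u = 0` off `Z`), then there is
`W` with linear columns and degree-`≤ d` rows at Hamming distance `≤ 2^{L−1}·#Z` from `X`.  (The hypothesis is used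
only at the basis rows `e_i`; the correctors are extended linearly.) -/
theorem exists_lift_of_transversal {d : ℕ} (Z : Finset (Fin L' → Bool)) {X : BMat L L'} (hX : LinCols X)
    (H : ∀ u, ∃ v : (Fin L' → Bool) → Bool, (∀ p, v p = true → p ∈ Z) ∧ HasDeg (fun p => xor (X u p) (v p)) d) :
    ∃ W : BMat L L', LinCols W ∧ RowsDeg d W ∧ hw (xorM X W) ≤ 2 ^ (L - 1) * Z.card := by
  classical
  choose v hvZ hvdeg using H
  refine ⟨liftZ X (fun i => v (basisRow i)), linCols_liftZ hX _, rowsDeg_liftZ hX fun i => hvdeg _, ?_⟩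
  rw [hw_xorM_eq_of_linCols hX (linCols_liftZ hX _)]
  exact Nat.mul_le_mul_left _ (card_le_card (colDiff_liftZ_subset _ Z fun i p hp => hvZ _ p hp))

open LiftFromTransversal in
/-- **Real-valued cost form** (the shape of `LiftOneUAt` / `CostBoundCodegTwo` conclusions): under the same
hypotheses, `hw (X ⊕ W) ≤ #Z · 2^L / 2`. -/
theorem exists_lift_of_transversal_real {d : ℕ} (Z : Finset (Fin L' → Bool)) {X : BMat L L'} (hX : LinCols X)
    (H : ∀ u, ∃ v : (Fin L' → Bool) → Bool, (∀ p, v p = true → p ∈ Z) ∧ HasDeg (fun p => xor (X u p) (v p)) d) :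
    ∃ W : BMat L L', LinCols W ∧ RowsDeg d W ∧ (hw (xorM X W) : ℝ) ≤ Z.card * (2 : ℝ) ^ L / 2 := by
  obtain ⟨W, hW, hWd, hcost⟩ := exists_lift_of_transversal Z hX H
  refine ⟨W, hW, hWd, ?_⟩
  have h1 : (hw (xorM X W) : ℝ) ≤ (2 : ℝ) ^ (L - 1) * Z.card := by exact_mod_cast hcost
  rcases Nat.eq_zero_or_pos L with hL | hL
  · -- `L = 0`: one row; `2^(0-1) = 1`
    -- `L = 0`: the only row is the zero row, where both `X` and `W` vanish (linear columns), so the cost is `0`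
    subst hL
    have hzero : hw (xorM X W) = 0 := by
      unfold hw
      rw [Finset.card_eq_zero, filter_eq_empty_iff]
      intro q _
      have hq : q.1 = fun _ => false := funext fun i => i.elim0
      unfold xorM
      rw [hq, hX.2 q.2, hW.2 q.2]
      decide
    rw [hzero, Nat.cast_zero]; positivity
  · obtain ⟨k, rfl⟩ : ∃ k, L = k + 1 := ⟨L - 1, by omega⟩
    simp only [Nat.add_sub_cancel] at h1
    rw [pow_succ]
    linarith

end Summit.QuantumAdvantage.AdviceFreeQNC0
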